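import Mathlib
import HarnessLib
import HarnessLib.Audit
import Summits.HodgeConjecture.Statement
import Literature.AlgebraicGeometry.Tropical.TorusCycles
import Literature.AlgebraicGeometry.Tropical.TorusCyclesBasic
import Literature.AlgebraicGeometry.HodgeTheory.WeilClasses
import Literature.AlgebraicTopology.SingularHomology.CupProduct
import Literature.AlgebraicGeometry.Motives.AbelianVarietyProjectiveChart
import HarnessLib.Audit.Status.Attr

/-!
Route: TropicalWeilObstruction

# Route TropicalWeilObstruction — Kontsevich's tropical test, negative branch — a Weil-functional
obstruction to effective tropical 4-cycles on very general tropical Weil eightfolds refutes HC via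
the Mumford–Weil shadow

REFUTATION route (closes : … → ¬ HodgeConjecture). X = K1 ∧ K2 ∧ K3 ∧ S: (K1, TROPICAL WEIL
VANISHING) on the very general principally
polarised tropical Weil eightfold X_Q = ℝ⁸/Q·ℤ⁸ (Q positive definite, QJ = JQ for the integral
complex structure J = weilJ 4, the 16 free
entries of Q algebraically independent over ℚ) every effective tropical 4-cycle Z has Weil
functional W(Z) = Σ_σ w_σ a_σ η_σ² = 0;
(K2, MUMFORD–WEIL SHADOW) over every such Q sits a complex abelian eightfold A with φ² = −1 carrying
a cup-non-degenerate triple of rational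
(4,4)-classes, two of them spanning the Weil plane, such that every cup-non-degenerate family of m
rational ALGEBRAIC (4,4)-classes on A casts
m ℚ-linearly independent effective tropical 4-cycle classes on X_Q; (K3, TROPICAL HODGE BOUND) three
effective tropical 4-cycles on X_Q with
W = 0 have ℚ-dependent classes; (S) such a Q exists. HC makes the K2-triple algebraic, K2 casts it
to three independent tropical classes,
K1 gives them W = 0, K3 says they are dependent. Cards realised: tropical-weil-eightfold-obstruction
(spine), tropical-weil-torus-g8 (merged sibling).
Lean: `Summit.HodgeConjecture.HodgeConjecture.Theses.TropicalWeilObstruction.TropicalWeilVanishing ∧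
Summit.HodgeConjecture.HodgeConjecture.Theses.TropicalWeilObstruction.MumfordWeilShadow ∧
Summit.HodgeConjecture.HodgeConjecture.Theses.TropicalWeilObstruction.TropicalHodgeBound ∧
Summit.HodgeConjecture.HodgeConjecture.Theses.TropicalWeilObstruction.GenericWeilPeriod`

## Assembly
Pure logic (sorry-free `assembly_holds` in Sketch.lean; the deciding theorem `closes` is Assembly
applied to the four items): assume HC; take Q from GenericWeilPeriod; MumfordWeilShadow gives A, φ,
u and the
shadow property; A is smooth projective of dimension 8 (AbelianVariety.isSmoothProjective_holds,
A.dim = 8), so HC puts every u_k in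
algebraicClasses A.X 4; the shadow property applied to u (m = 3, cup-non-degenerate by K2) yields
three effective tropical 4-cycles with
ℚ-independent classes; TropicalWeilVanishing gives each W = 0; TropicalHodgeBound says they are
dependent — contradiction, hence ¬HC.

Rationale: WHY THIS LINE. Kontsevich's proposal (Zharkov2020TropicalWeil pp. 2–4): if the TROPICAL Hodge
conjecture fails on a tropical abelian variety X_Q with
irrational periods, the very general fibre of the Mumford degeneration with tropical limit X_Q
violates the classical Hodge conjecture; the
natural candidates are the two tropical Weil classes, which the Weil functional W (the
(dz⊗dz)-component of the cycle class, dz = dz₁∧…∧dz₄)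
separates from the theta class. We run the test in dimension EIGHT (g = 8, p = 4, K = ℚ(i)), the
first Weil dimension not settled classically
(Markman2025SecantWeil / Markman2025SurveySecant Thm 1.2: fourfolds, split sixfolds;
Schoen1988HodgeWeil: the 12-dimensional Prym locus only),
where the prior programme's unpublished computations (archive hodge-neg/y1: n = 2, 3 tropical
HC(n,n) TRUE, n = 4 dichotomy Thm J, Prym–Weil
locus of rank 12 < 16) point to rigidity of every known effective tropical Weil 4-cycle. Imported
areas: tropical homology of tori
(MikhalkinZharkov2014Eigenwave Prop. 4.3, Thm 5.4; AminiPiquerez2020TropicalHC for contrast),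
non-archimedean/Mumford degenerations and
tropicalisation of cycles (arXiv:math/0609383, arXiv:1604.01838), transcendence (algebraic
independence of periods as the genericity notion).
What it does that prior routes do not: every existing Hodge route on the Weil sector (HeckePrymWeil,
NodalThetaWeil, PadicSemiregularLift,
SupersingularIsotypicLift, the retired TropicalCuspLift) PROVES algebraicity or uses tropical Weil
tori as anchors to LIFT cycles; the
period-audit refutation routes (DeltaPeriodAudit, SecondaryPeriods) test modular periods. This is
the first negative-side route whose open
content (K1) is a statement about finite balanced polyhedral complexes in ℝ⁸, with the passage to
¬HC carried by a transfer statement (K2)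
that is a theorem-to-formalise of degeneration theory, true independently of HC.

RANKED CRUXES. #2 TropicalWeilVanishing (crux) — for every positive definite Q commuting with J =
weilJ 4 whose 16 free entries are algebraically independent over ℚ, every effective tropical 4-cycle
Z on ℝ⁸/Q·ℤ⁸ (weighted framed lattice 4-simplices with a facet-class balancing certificate) has
weilFunctional Z = 0 (card K1; the negation of alternative (i) of the archive's eightfold
dichotomy). [difficulty: open-problem] (why it might fail: it is the ¬HC bet: ONE tropically
semiregular effective 4-cycle with W ≠ 0 at ONE rational Q (e.g. a MUW-refined Schoen–Prym cycle of
a genus-5 graph deforming in all 16 directions, not only the 12 Prym ones) spreads to generic Q and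
refutes it by finite exact linear algebra.) [Zharkov2020TropicalWeil, MikhalkinZharkov2014Eigenwave,
AminiPiquerez2020TropicalHC, Schoen1988HodgeWeil, arXiv:1710.06401]
#3 MumfordWeilShadow (crux) — for every such Q there are a complex abelian eightfold A, φ : A ⟶ A
with φ ≫ φ = −𝟙, and u₀,u₁,u₂ ∈ H⁸(A(ℂ);ℂ) rational of Hodge type (4,4) with u₁,u₂ in the Weil plane
weilClassesOf A φ 4 1 and the cup form on their ℚ-span non-degenerate, such that for every m and
every family a₁…a_m of rational classes in algebraicClasses A.X 4 whose ℚ-span is cup-non-degenerate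
there are m effective tropical 4-cycles on ℝ⁸/Q·ℤ⁸ with ℚ-linearly independent classes cyc (card K2:
the very general fibre of the Mumford–Weil family over the cone of Q, Thms E/F/H of the archive =
specialisation of effective cycles to effective tropical cycles preserving classes and intersection
numbers). [difficulty: XL] (why it might fail: specialising an effective cycle to an effective
tropical cycle needs semistable reduction over a non-discrete valuation (value group of rational
rank 16); class/intersection compatibility is unpublished in this generality; building A in the
tree's AbelianVariety API is heavy.) [Zharkov2020TropicalWeil, arXiv:math/0609383, arXiv:1604.01838,
vanGeemen1994HodgeAV, Deligne1982HodgeCycles, Weil1977]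
#4 TropicalHodgeBound (crux) — for every such Q, three effective tropical 4-cycles on ℝ⁸/Q·ℤ⁸ with
vanishing Weil functional have ℚ-linearly dependent classes (card K3/K4: rationality of tropical
cycle classes, [Z] ∈ ⋀⁴(Qℤ⁸) ⊗ ⋀⁴ℤ⁸ ∩ ker φ_Q, the generic kernel has ℚ-rank 3 = ⟨θ₄, w₁, w₂⟩ — the
rank-4897/4900 certificate — and W(θ₄) = 0, W(w₁), W(w₂) ℝ-independent). [difficulty: L] (why it
might fail: the generic-rank count 4900 − 4897 = 3 is a finite exact computation not yet certified
in Lean (a fourth rational tropical Hodge class at generic Weil Q would break it); rationality of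
cyc needs the closedness certificate to imply the homology statement for non-simplicial supports.)
[MikhalkinZharkov2014Eigenwave, Zharkov2020TropicalWeil, arXiv:1604.01838]
#9 GenericWeilPeriod (support) — there is a positive definite real 8×8 matrix Q with QJ = JQ whose
16 free entries (weilFreeIndex 4) are algebraically independent over ℚ (Lindemann–Weierstrass on Q =
c·1 + ε·(generic symmetric J-commuting direction), or a cardinality/transcendence-degree argument).
[difficulty: M] [Zharkov2020TropicalWeil]

TWO-LAYER PLAN. Foreseen glued splits (not filed): TropicalWeilVanishing ⇐ GenericSpread (a W ≠ 0
effective cycle at a generic Q persists on a non-empty open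
set of the Weil period domain: ℚ-semialgebraicity of realisation loci + genericity) →
NoOpenWeilLocus (no non-empty open set of the Weil domain
carries W ≠ 0 effective 4-cycles everywhere) → TropicalWeilVanishing; TropicalHodgeBound ⇐
WeilLinear (W = Ŵ ∘ cyc for a fixed linear Ŵ) →
RationalHodgeSpan (cyc Z ∈ ℚ-span of three classes E₀,E₁,E₂ with Ŵ E₀ = 0, Ŵ E₁, Ŵ E₂ ℚ-independent)
→ TropicalHodgeBound; MumfordWeilShadow ⇐
MumfordWeilDatum existence (fibre + specialisation map ι with effective saturation and injectivity
on cup-non-degenerate algebraic spans) →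
independent-subfamily extraction (linear algebra) → MumfordWeilShadow. The birth skeletons
bc/*_birth.lean realise exactly these.

KILL CRITERIA. ONE effective tropical 4-cycle with W ≠ 0 over ONE generic Q — in practice a
tropically semiregular W ≠ 0 cycle at a rational Q, certified by
exact linear algebra (the archive's planned cube-ℤ/4-cover Schoen–Prym job: rank 16 of the
deformation map ⇒ refuted; 12 predicted) — refutes
TropicalWeilVanishing: close `refuted:TropicalWeilVanishing` (it proves tropical HC(4,4) at very
general Weil eightfolds, decides nothing on HC).
A classical proof that Weil classes on very general Weil eightfolds over ℚ(i) are algebraic (an n =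
4 secant construction à la Markman, or
variational Hodge for genus-5 Schoen–Prym cycles) refutes TropicalWeilVanishing through
MumfordWeilShadow + TropicalHodgeBound and kills the
route. A fourth generic rational tropical Hodge class refutes TropicalHodgeBound (pivot: restate
with the correct rank). MumfordWeilShadow
refuted-substantive (specialisation loses effectivity or classes irreparably) retires the line
`not-a-thesis` for tropical tests in general.

NOT DECOMPOSED YET. The combinatorial-type / realisation-locus formalism behind GenericSpread (layer
2 of K1); Kontsevich's uniform dual certificate Φ (the
intended PROOF of NoOpenWeilLocus); the Mumford–Weil family itself (relative dimension 8 over a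
16-dimensional base), semistable models and
the specialisation map ι (layer 2 of K2); the rank-4897 certificate as an imported computation
(layer 2 of K3); any d > 1 or K ≠ ℚ(i) variant.

CHEAPEST FALSIFIER. The deformation-criterion rank test on ONE MUW-realisable refined Schoen–Prym
tropical 4-cycle of a genus-5 cube ℤ/4-cover at a rational Weil
Q: rank of the linearised realisation map in the 16 Weil directions. 16 ⇒ TropicalWeilVanishing is
false (route dead, tropical HC(4,4) very
generally true); 12 (= the Prym rank, archive Prop. 9.8(a)) ⇒ the line survives its cheapest test.
One `kit compute` job (exact rational
linear algebra, hours); not run in this typing seat (no cycle instance is digitised in the tree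
yet).

NUMBERS. g = 8, p = 4, K = ℚ(i) (d = 1), J = weilJ 4; Weil period domain of real dimension n² = 16
(weilFreeIndex 4); ⋀⁴ℝ⁸ ⊗ ⋀⁴ℝ⁸ of dimension
70·70 = 4900, generic tropical Hodge rank 3 (eigenwave rank 4897, archive Lemma 8.13, certified mod
p = 2⁶¹−1 and by three integral samples);
Schoen–Prym locus rank 12 < 16 for genus 5 (3q−3 ≥ (q−1)² iff q ≤ 4); classical status: Weil classes
algebraic on all Weil fourfolds and split
sixfolds (Markman2025SecantWeil), open from eightfolds on (arXiv:2603.20268 §1). Items at open: 5 (3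
cruxes, 1 support, 1 assembly; `closes` = Assembly applied to the four).

DEFINITION REQUESTS. None outstanding: TropicalCell, TropicalTorusCycle (+ cyc), weilJ,
frameComplexDet, weilFunctional, weilFreeIndex, IsWeilGeneric landed as
Literature/AlgebraicGeometry/Tropical/TorusCycles.lean (p169454, this seat; cites
MikhalkinZharkov2014Eigenwave, Zharkov2020TropicalWeil).
Wanted later (layer 2, not filed): realisation locus of a combinatorial type; MumfordWeilDatum
(fibre + specialisation map).

Novelty: Searches (2026-08-17): `lit search "tropical Hodge conjecture"` (corpus 5: paper:arxiv-2012.13142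
pp.2–3, paper:arxiv-2002.02347 p.2, arxiv-1909.12633 p.21, arxiv-2106.11479 p.11, arxiv-2009.04690
p.4; remote 13, nothing on Weil eightfolds); `lit search --hybrid "tropical Hodge conjecture abelian
varieties Weil classes Kontsevich"` (8 books: voisin2002 p.261, green1994 p.219, kerr2016 p.302,
deligne1982 p.79 — classical only); `lit vsearch "<K1 in prose>"` (8 classical books, no tropical
hit); `lit galaxy search "tropical Hodge conjecture|tropical abelian variet|Weil classes" --star
all` (14 rows: [galaxy:pdf:-8405055998839152860] Deligne–Milne Hodge cycles = barrier source; no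
tropical-test paper); `lit galaxy search "Zharkov|eigenwave|rationally triangulable" --star all` (30
rows, all noise); sketch-stage searches (Markman2025SurveySecant p.3 Question 1.1/Thm 1.2 and its
pointer to Zharkov's "computer aided attempt"; arXiv:2603.20268 pp.1–3; arXiv:2607.18341 pp.1–2;
arXiv:2506.13729 Thm 1.2); `lean search Tropical --decl`; all 62 Theses of the sub read by lever;
`ledger negatives --problem HodgeConjecture` (3, unrelated).
Nearest prior art found: Zharkov2020TropicalWeil [corpus:paper:arxiv-2002.02347 p.2–3] (Kontsevich's
scheme made explicit for n = 2, no decision; "the converse implication though may be false");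
AminiPiquerez2020TropicalHC [corpus:paper:arxiv-2012.13142 p.2–3] (tropical HC for rationally
triangulable varieties — tropical abelian varieties with irrational Q  [refs: 2603.20268, 2607.18341, 2506.13729, 2507.15704, paper:arxiv-2012.13142, paper:arxiv-2002.02347, arxiv-1909.12633, arxiv-2106.11479, arxiv-2009.04690]

Barriers (technique_class: refutation tropical-degeneration weil-classes counterexample): - technique_class: refutation tropical-degeneration weil-classes counterexample
- Literature.Barriers.HodgeConjecture.Andre1996_hodgeClassesOnAbelianVarieties_motivated: INSIDE its
technique class (counterexample-on-abelian-variety, weil-classes) and the route does not evade it —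
the barrier is a PRICE, not a no-go: by `not_lefschetzStandardConjecture_of_counterexample` /
`HodgeCounterexampleOnAbelianVariety.not_hodgeConjectureOver` (Andre1996 Thm 0.6.2, Rem. 6.3.2) the
route's conclusion (a motivated, absolute-Hodge, non-algebraic Weil class on an abelian eightfold)
refutes Grothendieck's standard conjecture B on André's compact pencils of abelian varieties; the
bet is exactly that, and no step of the line uses B, Künneth or Lefschetz-type inputs.
- Literature.Barriers.HodgeConjecture.hodgeClassesAreAbsoluteFor_abelianVariety: outside its
technique class — Deligne 1982: Hodge classes on abelian varieties are absolute Hodge, so no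
refutation on an abelian variety can run through a Galois-conjugation / field-of-definition test;
this route never does: the target Weil classes ARE absolute Hodge, and non-algebraicity is detected
by tropical specialisation of EFFECTIVE cycles (MumfordWeilShadow) against a tropical functional
(TropicalWeilVanishing), a test invisible to absoluteness. Consistent: the conclusion is an
absolute-Hodge non-algebraic class.
- Literature.Barriers.HodgeConjecture.CattaniDeligneKaplan1995_hodgeLocus_algebraicFor: outside — no
step argues from transcendence

sub-problem: HodgeConjecture · status: draft · opened planner-type-34c00b471c-0 2026-08-17T16:32:26Z · rev 0 · ledger route-HodgeConjecture-TropicalWeilObstruction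
GENERATED by the gate from the ledger (D-0016/17). Provers cite these decls: `theorem foo : Summit.HodgeConjecture.HodgeConjecture.Theses.TropicalWeilObstruction.<Decl> := …` in Summits/HodgeConjecture/HodgeConjecture/Theorems/<Name>.lean.
-/

namespace Summit.HodgeConjecture.HodgeConjecture.Theses.TropicalWeilObstruction

open scoped BigOperators Topology Manifold Classical MeasureTheory ProbabilityTheory Matrix InnerProductSpace ComplexConjugate ContinuousMap
open Filter Set Function TopologicalSpace MeasureTheory

attribute [summit_statement] _root_.HodgeConjecture

/-- item stmt-HodgeConjecture-18478 · crux · rank 2 · open · by planner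
why it might fail: it is the ¬HC bet: ONE tropically semiregular effective 4-cycle with W ≠ 0 at ONE rational Q (e.g. a MUW-refined Schoen–Prym cycle of a genus-5 graph deforming in all 16 directions, not only the 12 Prym ones) spreads to generic Q and refutes it by finite exact linear algebra.
sources: Zharkov2020TropicalWeil, MikhalkinZharkov2014Eigenwave, AminiPiquerez2020TropicalHC, Schoen1988HodgeWeil, arXiv:1710.06401
[crux] for every positive definite Q commuting with J = weilJ 4 whose 16 free entries are
algebraically independent over ℚ, every effective tropical 4-cycle Z on ℝ⁸/Q·ℤ⁸ (weighted framed
lattice 4-simplices with a facet-class balancing certificate) has weilFunctional Z = 0 (card K1; the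
negation of alternative (i) of the archive's eightfold dichotomy). [difficulty: open-problem] -/
@[route_item "route-HodgeConjecture-TropicalWeilObstruction", crux]
def TropicalWeilVanishing : Prop :=
  ∀ Q : Matrix (Fin (2 * 4)) (Fin (2 * 4)) ℝ, Q.PosDef → Q * Literature.AlgebraicGeometry.Tropical.weilJ 4 = Literature.AlgebraicGeometry.Tropical.weilJ 4 * Q → Literature.AlgebraicGeometry.Tropical.IsWeilGeneric 4 Q → ∀ Z : Literature.AlgebraicGeometry.Tropical.TropicalTorusCycle (2 * 4) 4 Q, Literature.AlgebraicGeometry.Tropical.weilFunctional Z = 0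

/-- item stmt-HodgeConjecture-18479 · crux · rank 3 · open · by planner
why it might fail: specialising an effective cycle to an effective tropical cycle needs semistable reduction over a non-discrete valuation (value group of rational rank 16); class/intersection compatibility is unpublished in this generality; building A in the tree's AbelianVariety API is heavy.
sources: Zharkov2020TropicalWeil, arXiv:math/0609383, arXiv:1604.01838, vanGeemen1994HodgeAV, Deligne1982HodgeCycles, Weil1977
[crux] for every such Q there are a complex abelian eightfold A, φ : A ⟶ A with φ ≫ φ = −𝟙, and
u₀,u₁,u₂ ∈ H⁸(A(ℂ);ℂ) rational of Hodge type (4,4) with u₁,u₂ in the Weil plane weilClassesOf A φ 4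
1 and the cup form on their ℚ-span non-degenerate, such that for every m and every family a₁…a_m of
rational classes in algebraicClasses A.X 4 whose ℚ-span is cup-non-degenerate there are m effective
tropical 4-cycles on ℝ⁸/Q·ℤ⁸ with ℚ-linearly independent classes cyc (card K2: the very general
fibre of the Mumford–Weil family over the cone of Q, Thms E/F/H of the archive = specialisation of
effective cycles to effective tropical cycles preserving classes and intersection numbers).
[difficulty: XL] -/
@[route_item "route-HodgeConjecture-TropicalWeilObstruction", crux]
def MumfordWeilShadow : Prop :=
  ∀ Q : Matrix (Fin (2 * 4)) (Fin (2 * 4)) ℝ, Q.PosDef → Q * Literature.AlgebraicGeometry.Tropical.weilJ 4 = Literature.AlgebraicGeometry.Tropical.weilJ 4 * Q → Literature.AlgebraicGeometry.Tropical.IsWeilGeneric 4 Q → ∃ (A : Literature.AlgebraicGeometry.Motives.AbelianVariety ℂ) (φ : A ⟶ A) (u : Fin 3 → Literature.AlgebraicTopology.SingularHomology.singularCohomology ℂ ℂ (Literature.AlgebraicGeometry.Motives.ComplexPoints A.X) (2 * 4)), A.dim = 8 ∧ CategoryTheory.CategoryStruct.comp φ φ = -(CategoryTheory.CategoryStruct.id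 A) ∧ (∀ k, Literature.AlgebraicGeometry.HodgeTheory.IsRationalClass (u k) ∧ Literature.AlgebraicGeometry.HodgeTheory.IsOfHodgeType 8 A.X (2 * 4) 4 4 (u k)) ∧ u 1 ∈ Literature.AlgebraicGeometry.HodgeTheory.weilClassesOf A φ 4 1 ∧ u 2 ∈ Literature.AlgebraicGeometry.HodgeTheory.weilClassesOf A φ 4 1 ∧ (∀ l : Fin 3 → ℚ, l ≠ 0 → ∃ k', Literature.AlgebraicTopology.SingularHomology.cupProduct (show 2 * 4 + 2 * 4 = 16 by norm_num) (∑ k, ((l k : ℚ) : ℂ) • u k) (u k') ≠ 0) ∧ ∀ (m : ℕ) (a : Fin m → Literature.AlgebraicTopology.SingularHomology.singularCohomology ℂ ℂ (Literature.AlgebraicGeometry.Motives.ComplexPoints A.X) (2 * 4)), (∀ k, Literature.AlgebraicGeometry.HodgeTheory.IsRationalClass (a k)) → (∀ k, a k ∈ Literature.AlgebraicGeometry.HodgeTheory.algebraicClasses A.X 4) → (∀ l : Fin m → ℚ, l ≠ 0 → ∃ k', Literature.AlgebraicTopology.SingularHomology.cupProduct (show 2 * 4 + 2 * 4 = 16 by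 norm_num) (∑ k, ((l k : ℚ) : ℂ) • a k) (a k') ≠ 0) → ∃ c : Fin m → Literature.AlgebraicGeometry.Tropical.TropicalTorusCycle (2 * 4) 4 Q, LinearIndependent ℚ fun k => (c k).cyc

/-- item stmt-HodgeConjecture-18480 · crux · rank 4 · closed · proved by Summit.HodgeConjecture.HodgeConjecture.Theorems.TropicalHodgeBound.tropicalHodgeBound_proof @ 5d436051211e (prover) · by planner
why it might fail: the generic-rank count 4900 − 4897 = 3 is a finite exact computation not yet certified in Lean (a fourth rational tropical Hodge class at generic Weil Q would break it); rationality of cyc needs the closedness certificate to imply the homology statement for non-simplicial supports.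
sources: MikhalkinZharkov2014Eigenwave, Zharkov2020TropicalWeil, arXiv:1604.01838
[crux] for every such Q, three effective tropical 4-cycles on ℝ⁸/Q·ℤ⁸ with vanishing Weil functional
have ℚ-linearly dependent classes (card K3/K4: rationality of tropical cycle classes, [Z] ∈ ⋀⁴(Qℤ⁸)
⊗ ⋀⁴ℤ⁸ ∩ ker φ_Q, the generic kernel has ℚ-rank 3 = ⟨θ₄, w₁, w₂⟩ — the rank-4897/4900 certificate —
and W(θ₄) = 0, W(w₁), W(w₂) ℝ-independent). [difficulty: L] -/
@[route_item "route-HodgeConjecture-TropicalWeilObstruction", crux]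
def TropicalHodgeBound : Prop :=
  ∀ Q : Matrix (Fin (2 * 4)) (Fin (2 * 4)) ℝ, Q.PosDef → Q * Literature.AlgebraicGeometry.Tropical.weilJ 4 = Literature.AlgebraicGeometry.Tropical.weilJ 4 * Q → Literature.AlgebraicGeometry.Tropical.IsWeilGeneric 4 Q → ∀ c : Fin 3 → Literature.AlgebraicGeometry.Tropical.TropicalTorusCycle (2 * 4) 4 Q, (∀ j, Literature.AlgebraicGeometry.Tropical.weilFunctional (c j) = 0) → ¬ LinearIndependent ℚ fun j => (c j).cyc

/-- item stmt-HodgeConjecture-18481 · support · rank 9 · closed · proved by Summit.HodgeConjecture.HodgeConjecture.Theorems.tropicalWeilObstruction_genericWeilPeriod_proof @ a4b415ef2382 (prover) · by planner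
sources: Zharkov2020TropicalWeil
[support] there is a positive definite real 8×8 matrix Q with QJ = JQ whose 16 free entries
(weilFreeIndex 4) are algebraically independent over ℚ (Lindemann–Weierstrass on Q = c·1 +
ε·(generic symmetric J-commuting direction), or a cardinality/transcendence-degree argument).
[difficulty: M] -/
@[route_item "route-HodgeConjecture-TropicalWeilObstruction", crux]
def GenericWeilPeriod : Prop :=
  ∃ Q : Matrix (Fin (2 * 4)) (Fin (2 * 4)) ℝ, Q.PosDef ∧ Q * Literature.AlgebraicGeometry.Tropical.weilJ 4 = Literature.AlgebraicGeometry.Tropical.weilJ 4 * Q ∧ Literature.AlgebraicGeometry.Tropical.IsWeilGeneric 4 Q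

/-- item stmt-HodgeConjecture-18482 · assembly · rank 1 · closed · proved by Summit.HodgeConjecture.HodgeConjecture.Theorems.tropicalWeilObstruction_assembly_proof @ dddebe5753b8 (prover) · by planner
sources: Zharkov2020TropicalWeil
[assembly] TropicalWeilVanishing → MumfordWeilShadow → TropicalHodgeBound → GenericWeilPeriod → ¬
HodgeConjecture (pure logic; proved in Sketch.lean as `assembly_holds`, attached as evidence for the
first prover). -/
@[route_item "route-HodgeConjecture-TropicalWeilObstruction", crux]
def Assembly : Prop :=
  TropicalWeilVanishing → MumfordWeilShadow → TropicalHodgeBound → GenericWeilPeriod → ¬ _root_.HodgeConjecture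

/-! D-0027 §2.1 — DECIDING THEOREM (planner-authored via `route open/edit --closes-file`; by planner-type-34c00b471c-0 2026-08-17T16:32:26Z):
its hypotheses are this route's items and its conclusion the sub-problem Statement (glue_lint), and it elaborates with this file. -/

@[closes "route-HodgeConjecture-TropicalWeilObstruction"] theorem closes (h₀ : Assembly) (h₁ : TropicalWeilVanishing) (h₂ : MumfordWeilShadow)
    (h₃ : TropicalHodgeBound) (h₄ : GenericWeilPeriod) : ¬ _root_.HodgeConjecture :=
  h₀ h₁ h₂ h₃ h₄

end Summit.HodgeConjecture.HodgeConjecture.Theses.TropicalWeilObstruction
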